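import Mathlib.Algebra.GroupWithZero.Action.Pointwise.Set
import Literature.Probability.LatticeModels.PlusStateFKG
import HarnessLib

/-!
# `+` boundary-condition correlations of the Ising model in a discretised domain

Topic `Probability/LatticeModels`. For a continuum domain `Ω ⊆ ℝ^d`, a mesh `δ` and an inverse
temperature `β`, the lattice region `Ω_δ := {z ∈ ℤ^d | δz ∈ Ω}` carries the `+` state of the
nearest-neighbour Ising model at `(β, h = 0)` with all spins outside `Ω_δ` frozen to `+1`
(Friedli–Velenik 2017, §3.1, for finite volumes; Chelkak–Hongler–Izyurov 2015, §1.2, for the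
correlations `𝔼⁺_{Ω_δ}[σ_{a₁}⋯σ_{aₙ}]` of a discretised planar domain). When `Ω_δ` is infinite
(half-spaces, exteriors of balls, `Ω = ℝ^d`) the state is the limit of the finite-volume `+` states of
`Ω_δ ∩ B(L)`, `B(L) = {-L,…,L}^d`, which exists on spin monomials because these expectations are
eventually nonincreasing in `L` (GKS; Friedli–Velenik 2017, Exercise 3.12 / Lemma 3.22 — the tree
theorem `isingCorr_plus_le_of_subset`), exactly as for the plus state `plusExpect` (`Ω = ℝ^d`).

* `meshPos δ z = δz ∈ ℝ^d`; `domainBox Ω δ L = Ω_δ ∩ B(L)` as a `Finset (Site d)`;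
* `plusDomainCorr d Ω δ β : LatticeCorrFamily d`, `(n, y) ↦ ⟨∏ᵢ σ_{yᵢ}⟩⁺_{Ω_δ;β,0} :=
  lim_L ⟨∏ᵢ σ_{yᵢ}⟩⁺_{Ω_δ ∩ B(L);β,0}` (a `Filter.limUnder`; a genuine limit for `β ≥ 0`, and
  eventually constant in `L` for bounded `Ω`);
* `HasDomainScalingLimit d Ω β ρ S`: `ρ(δ)ⁿ ⟨∏ᵢ σ_{[xᵢ/δ]}⟩⁺_{Ω_δ;β,0} → S n x` as `δ → 0⁺`, locally
  uniformly on non-coincident configurations of points of `Ω` (Chelkak–Hongler–Izyurov 2015,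
  Thm. 1.2, transposed to `ℝ^d`).

API (all proved): the literal unfolding `plusDomainCorr_eq_limUnder` (the form inlined by the route
files of `Summits/CriticalPhenomena/Ising3DConformalLimit`; `rfl`), convergence, antitonicity in `Ω`,
the bulk bound `⟨∏σ⟩⁺_{β,0} ≤ ⟨∏σ⟩⁺_{Ω_δ}` for sites in `Ω_δ`, `Ω = ℝ^d` ↦ `plusExpect` /
`criticalCorr` at `β_c`, dilation consistency `(cΩ, cδ) ↔ (Ω, δ)`, `0 ≤ ⟨∏σ⟩⁺_{Ω_δ} ≤ 1`;
lattice-translation covariance is in `PlusDomainCorrShift.lean`.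

Design. Membership `δz ∈ Ω` is decided classically (`open scoped Classical`), as in the gate-written
route files that inline this object. The field is `h = 0` and the limit runs along the centred boxes,
as for `plusExpect`; values for `β < 0` are junk (possibly divergent sequence), as documented there.
Sites `yᵢ ∉ Ω_δ` are allowed: their spins are frozen to `+1` (`isingCorr_plus_eq_filter`).

## References

* S. Friedli, Y. Velenik, *Statistical Mechanics of Lattice Systems* (CUP 2017), §3.1 (finite-volume
  `+` states), Lemma 3.22 (p. 111), Exercise 3.12 (p. 112), Thm. 3.17 (p. 106), Thm. 3.20 (p. 109).
* D. Chelkak, C. Hongler, K. Izyurov, *Conformal invariance of spin correlations in the planar Ising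
  model*, Ann. Math. 181 (2015), §1.2 and Thm. 1.2.
-/

noncomputable section

open scoped Classical Pointwise
open MeasureTheory Filter Topology Finset Bornology

namespace Literature.Probability.LatticeModels

/-! ### Spin monomials under `+` boundary conditions (general graphs) -/

section General

variable {V : Type*} [DecidableEq V] (G : SimpleGraph V) [G.LocallyFinite]

omit [DecidableEq V] in
/-- `σ_v^k = σ_v` for odd `k` and `= 1` for even `k` (`σ_v² = 1`; Friedli–Velenik 2017, §3.6.1). [folklore] -/
private theorem spinAt_pow_eq_ite_odd_plusDomain (v : V) (s : SpinConfig V) (k : ℕ) :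
    spinAt v s ^ k = if Odd k then spinAt v s else 1 := by
  rcases spinAt_eq_one_or_eq_neg_one v s with h1 | h1 <;> rw [h1]
  · simp
  · split_ifs with hk
    · exact hk.neg_one_pow
    · exact (Nat.not_odd_iff_even.1 hk).neg_one_pow

/-- **A spin monomial is a spin product supported on its sites**: `∏ᵢ σ_{xᵢ} = σ_A` with `A` the
set of sites occurring an odd number of times in `x`, so `A ⊆ {x₁,…,xₙ}` (`σ_v² = 1`;
Friedli–Velenik 2017, §3.6.1, `σ_A σ_B = σ_{A △ B}`). [folklore] -/
theorem exists_subset_image_spinMonomial_eq_spinProduct {n : ℕ} (x : Fin n → V) :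
    ∃ A ⊆ univ.image x, spinMonomial x = spinProduct A := by
  refine ⟨(univ.image x).filter fun v => Odd #(univ.filter fun i => x i = v),
    Finset.filter_subset _ _, funext fun s => ?_⟩
  unfold spinMonomial spinProduct
  rw [Finset.prod_comp (fun v => spinAt v s) x, Finset.prod_filter]
  exact Finset.prod_congr rfl fun v _ => spinAt_pow_eq_ite_odd_plusDomain v s _

/-- **Spins outside the volume are frozen to `+1` under the `+` boundary condition**:
`⟨σ_A⟩⁺_{Λ;β,h} = ⟨σ_{A ∩ Λ}⟩⁺_{Λ;β,h}` for every finite `A` (Friedli–Velenik 2017, §3.1: the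
measure `μ⁺_{Λ;β,h}` lives on `Ω⁺_Λ = {ω : ωᵢ = +1, i ∉ Λ}`). [cite: FriedliVelenik2017, §3.1] -/
theorem isingCorr_plus_eq_filter (Λ : Finset V) (β h : ℝ) (A : Finset V) :
    isingCorr G Λ β h .plus A = isingCorr G Λ β h .plus (A.filter (· ∈ Λ)) := by
  rw [isingCorr, isingCorr, isingExpect, isingExpect,
    integral_isingMeasure G Λ β h _ (measurable_spinProduct _),
    integral_isingMeasure G Λ β h _ (measurable_spinProduct _)]
  congr 1
  refine Finset.sum_congr rfl fun τ _ => ?_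
  congr 1
  rw [spinProduct, spinProduct, ← Finset.prod_filter_mul_prod_filter_not A (· ∈ Λ),
    Finset.prod_eq_one (s := A.filter fun x => ¬x ∈ Λ) ?_, mul_one]
  intro x hx
  rw [spinAt_glue_of_not_mem τ .plus (Finset.mem_filter.1 hx).2, spinAt, plus_outside_apply]
  simp

end General

section Zd

variable {d : ℕ}

/-! ### Mesh positions and discretised domains -/

/-- The position `δz ∈ ℝ^d` of the lattice site `z ∈ ℤ^d` at mesh `δ`, the point with coordinates
`δ zᵢ` (Chelkak–Hongler–Izyurov 2015, §1.2, the rescaled lattice `δℤ²`). [cite: ChelkakHonglerIzyurov2015, §1.2] -/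
def meshPos (δ : ℝ) (z : Site d) : EuclideanSpace ℝ (Fin d) :=
  WithLp.toLp 2 fun i : Fin d => δ * (z i : ℝ)

/-- Coordinates of `meshPos`. [folklore] -/
@[simp] theorem meshPos_apply (δ : ℝ) (z : Site d) (i : Fin d) : meshPos δ z i = δ * (z i : ℝ) :=
  rfl

/-- Dilation of the mesh: `meshPos (cδ) z = c • meshPos δ z`. [folklore] -/
theorem meshPos_mul (c δ : ℝ) (z : Site d) : meshPos (c * δ) z = c • meshPos δ z := by
  ext i
  simp [mul_assoc]

/-- Each coordinate `|δ zᵢ|` is bounded by the Euclidean norm `‖δz‖`. [folklore] -/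
theorem abs_mul_le_norm_meshPos (δ : ℝ) (z : Site d) (i : Fin d) :
    |δ * (z i : ℝ)| ≤ ‖meshPos δ z‖ := by
  simpa only [meshPos_apply, Real.norm_eq_abs] using PiLp.norm_apply_le (meshPos δ z) i

/-- The lattice approximation `[·/δ]` of `ScalingLimit.lean` inverts `meshPos δ` for `δ > 0`:
`[δz/δ] = z`. [folklore] -/
@[simp] theorem latticeApprox_meshPos {δ : ℝ} (hδ : 0 < δ) (z : Site d) :
    latticeApprox δ (meshPos δ z) = z := by
  funext i
  rw [latticeApprox_apply, meshPos_apply, mul_div_cancel_left₀ _ hδ.ne', Int.floor_intCast]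

/-- **The discretised domain cut off at the box `B(L)`**: `domainBox Ω δ L = Ω_δ ∩ B(L)`, the sites
`z ∈ {-L,…,L}^d` with `δz ∈ Ω`, where `Ω_δ = {z ∈ ℤ^d | δz ∈ Ω}` is the lattice region of the
continuum domain `Ω` at mesh `δ` (Chelkak–Hongler–Izyurov 2015, §1.2; Friedli–Velenik 2017, §3.1 for
finite volumes `Λ ⋐ ℤ^d`). Membership in `Ω` is decided classically. [cite: ChelkakHonglerIzyurov2015, §1.2] -/
def domainBox (Ω : Set (EuclideanSpace ℝ (Fin d))) (δ : ℝ) (L : ℕ) : Finset (Site d) :=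
  (box d L).filter fun z => meshPos δ z ∈ Ω

/-- Membership in `domainBox Ω δ L`. [folklore] -/
@[simp] theorem mem_domainBox {Ω : Set (EuclideanSpace ℝ (Fin d))} {δ : ℝ} {L : ℕ} {z : Site d} :
    z ∈ domainBox Ω δ L ↔ z ∈ box d L ∧ meshPos δ z ∈ Ω := by
  simp [domainBox]

/-- `Ω_δ ∩ B(L) ⊆ B(L)`. [folklore] -/
theorem domainBox_subset_box (Ω : Set (EuclideanSpace ℝ (Fin d))) (δ : ℝ) (L : ℕ) :
    domainBox Ω δ L ⊆ box d L :=
  Finset.filter_subset _ _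

/-- `Ω_δ ∩ B(L)` is nondecreasing in `L`. [folklore] -/
theorem domainBox_mono (Ω : Set (EuclideanSpace ℝ (Fin d))) (δ : ℝ) : Monotone (domainBox Ω δ) :=
  fun _ _ h => Finset.filter_subset_filter _ (box_mono d h)

/-- `Ω_δ ∩ B(L)` is nondecreasing in `Ω`. [folklore] -/
theorem domainBox_mono_set {Ω Ω' : Set (EuclideanSpace ℝ (Fin d))} (h : Ω ⊆ Ω') (δ : ℝ) (L : ℕ) :
    domainBox Ω δ L ⊆ domainBox Ω' δ L :=
  fun _ hz => mem_domainBox.2 ⟨(mem_domainBox.1 hz).1, h (mem_domainBox.1 hz).2⟩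

/-- For `Ω = ℝ^d` the discretised domain cut off at `B(L)` is the whole box. [folklore] -/
@[simp] theorem domainBox_univ (δ : ℝ) (L : ℕ) :
    domainBox (Set.univ : Set (EuclideanSpace ℝ (Fin d))) δ L = box d L := by
  ext z
  simp

/-- **Exact dilation consistency of the discretisation**: `(cΩ)_{cδ} = Ω_δ` for `c ≠ 0`. [folklore] -/
theorem domainBox_smul {c : ℝ} (hc : c ≠ 0) (Ω : Set (EuclideanSpace ℝ (Fin d))) (δ : ℝ) (L : ℕ) :
    domainBox (c • Ω) (c * δ) L = domainBox Ω δ L := by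
  ext z
  simp only [mem_domainBox, meshPos_mul, Set.smul_mem_smul_set_iff₀ hc]

/-- A set of sites with mesh points in `Ω` lies in `Ω_δ ∩ B(L)` once it lies in `B(L)`. [folklore] -/
theorem subset_domainBox_of_subset_box {Ω : Set (EuclideanSpace ℝ (Fin d))} {δ : ℝ} {A : Finset (Site d)}
    (hA : ∀ z ∈ A, meshPos δ z ∈ Ω) {L : ℕ} (hL : A ⊆ box d L) : A ⊆ domainBox Ω δ L :=
  fun z hz => mem_domainBox.2 ⟨hL hz, hA z hz⟩

/-- The sites of a spin product representing `∏ᵢ σ_{yᵢ}` have mesh points in `Ω` when the `yᵢ` do. [folklore] -/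
theorem forall_meshPos_mem_of_subset_image {Ω : Set (EuclideanSpace ℝ (Fin d))} {δ : ℝ} {n : ℕ}
    {y : Fin n → Site d} (hy : ∀ i, meshPos δ (y i) ∈ Ω) {A : Finset (Site d)} (hA : A ⊆ univ.image y) :
    ∀ z ∈ A, meshPos δ z ∈ Ω := fun z hz => by
  obtain ⟨i, -, rfl⟩ := Finset.mem_image.1 (hA hz)
  exact hy i

/-- **A bounded domain has a finite discretisation**: if `Ω` is bounded and `δ ≠ 0`, the cut-off
regions `Ω_δ ∩ B(L)`, `L ≥ L₀`, all equal `Ω_δ = Ω_δ ∩ B(L₀)` (`δz ∈ Ω` forces `|zᵢ| ≤ R/|δ|`). [folklore] -/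
theorem exists_forall_domainBox_eq_of_isBounded {Ω : Set (EuclideanSpace ℝ (Fin d))} (hΩ : IsBounded Ω)
    {δ : ℝ} (hδ : δ ≠ 0) : ∃ L₀ : ℕ, ∀ L, L₀ ≤ L → domainBox Ω δ L = domainBox Ω δ L₀ := by
  obtain ⟨R, hR⟩ := hΩ.exists_norm_le
  refine ⟨⌈R / |δ|⌉₊, fun L hL => Finset.Subset.antisymm (fun z hz => ?_) (domainBox_mono Ω δ hL)⟩
  rw [mem_domainBox] at hz ⊢
  refine ⟨mem_box.2 fun i => ?_, hz.2⟩
  have h1 : |(z i : ℝ)| ≤ R / |δ| := by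
    rw [le_div_iff₀ (abs_pos.2 hδ), mul_comm, ← abs_mul]
    exact (abs_mul_le_norm_meshPos δ z i).trans (hR _ hz.2)
  have h2 : ((|z i| : ℤ) : ℝ) ≤ ((⌈R / |δ|⌉₊ : ℤ) : ℝ) := by
    rw [Int.cast_abs, Int.cast_natCast]
    exact h1.trans (Nat.le_ceil _)
  have h3 := abs_le.1 (Int.cast_le.1 h2)
  constructor <;> omega

/-! ### The `+` state of a discretised domain on spin monomials -/

variable (d) in
/-- **The `+` boundary-condition correlations of the Ising model in a discretised domain**:
`plusDomainCorr d Ω δ β n y = ⟨∏ᵢ σ_{yᵢ}⟩⁺_{Ω_δ;β,0} := lim_{L → ∞} ⟨∏ᵢ σ_{yᵢ}⟩⁺_{Ω_δ ∩ B(L);β,0}`,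
the expectation of the spin monomial `∏ᵢ σ_{yᵢ}` for the nearest-neighbour Ising model at inverse
temperature `β` and zero field in the lattice region `Ω_δ = {z ∈ ℤ^d | δz ∈ Ω}`, all spins outside
`Ω_δ` frozen to `+1` (Friedli–Velenik 2017, §3.1, `μ⁺_{Λ;β,h}`; Chelkak–Hongler–Izyurov 2015, §1.2,
`𝔼⁺_{Ω_δ}[σ_{a₁}⋯σ_{aₙ}]`), taken for infinite `Ω_δ` as the limit along the boxes `B(L)` (a
`Filter.limUnder`): for `β ≥ 0` the sequence is eventually nonincreasing (GKS, Friedli–Velenik 2017,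
Exercise 3.12 / Lemma 3.22) and converges (`tendsto_isingExpect_domainBox`); for bounded `Ω`, `δ ≠ 0`
it is eventually constant (`plusDomainCorr_eq_isingExpect_of_isBounded`). **Junk-valued** for `β < 0`
and unbounded `Ω` (possibly divergent sequence). [cite: FriedliVelenik2017, §3.1 and Lemma 3.22, p. 111] -/
def plusDomainCorr (Ω : Set (EuclideanSpace ℝ (Fin d))) (δ β : ℝ) : LatticeCorrFamily d :=
  fun _ y => limUnder atTop fun L : ℕ =>
    isingExpect (zdGraph d) (domainBox Ω δ L) β 0 .plus (spinMonomial y)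

/-- **Literal unfolding of `plusDomainCorr`**, in the form inlined (at `d = 3`, `β = β_c(3)`, as
`let G := fun Ω δ n y => Filter.limUnder atTop (fun L => isingExpect (zdGraph 3) ((box 3 L).filter
…) (criticalBeta 3) 0 .plus (spinMonomial y))`) by the route files of
`Summits/CriticalPhenomena/Ising3DConformalLimit`; the proof is `rfl`. [folklore] -/
theorem plusDomainCorr_eq_limUnder (Ω : Set (EuclideanSpace ℝ (Fin d))) (δ β : ℝ) (n : ℕ)
    (y : Fin n → Site d) :
    plusDomainCorr d Ω δ β n y =
      limUnder atTop (fun L : ℕ => isingExpect (zdGraph d)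
        ((box d L).filter fun z => (WithLp.toLp 2 (fun i : Fin d => δ * (z i : ℝ)) :
          EuclideanSpace ℝ (Fin d)) ∈ Ω) β 0 BoundaryCondition.plus (spinMonomial y)) :=
  rfl

/-- **Frozen sites**: in the volume `Ω_δ ∩ B(L)` with `+` boundary condition, the correlation of a
set of sites `A ⊆ B(L)` is that of its part with mesh points in `Ω` (the other spins are `+1`;
Friedli–Velenik 2017, §3.1). [cite: FriedliVelenik2017, §3.1] -/
theorem isingCorr_plus_domainBox_eq_filter {Ω : Set (EuclideanSpace ℝ (Fin d))} {δ : ℝ} (β h : ℝ)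
    {A : Finset (Site d)} {L : ℕ} (hL : A ⊆ box d L) :
    isingCorr (zdGraph d) (domainBox Ω δ L) β h .plus A =
      isingCorr (zdGraph d) (domainBox Ω δ L) β h .plus (A.filter fun z => meshPos δ z ∈ Ω) := by
  rw [isingCorr_plus_eq_filter (zdGraph d) (domainBox Ω δ L) β h A]
  congr 1
  refine Finset.filter_congr fun z hz => ?_
  rw [mem_domainBox]
  exact ⟨fun h => h.2, fun h => ⟨hL hz, h⟩⟩

/-- **Existence of the `+` state of a discretised domain on spin monomials** (Friedli–Velenik 2017,
Exercise 3.12, p. 112 / Lemma 3.22, p. 111, with Thm. 3.17): for `β ≥ 0` the expectations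
`⟨∏ᵢ σ_{yᵢ}⟩⁺_{Ω_δ ∩ B(L);β,0}` are nonincreasing in `L` once `B(L)` contains the `yᵢ` (GKS; sites
`yᵢ ∉ Ω_δ` carry frozen `+1` spins) and bounded, hence converge to `plusDomainCorr d Ω δ β n y`. [cite: FriedliVelenik2017, Exercise 3.12, p. 112] -/
theorem tendsto_isingExpect_domainBox {β : ℝ} (hβ : 0 ≤ β) (Ω : Set (EuclideanSpace ℝ (Fin d)))
    (δ : ℝ) {n : ℕ} (y : Fin n → Site d) :
    Tendsto (fun L : ℕ => isingExpect (zdGraph d) (domainBox Ω δ L) β 0 .plus (spinMonomial y))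
      atTop (𝓝 (plusDomainCorr d Ω δ β n y)) := by
  obtain ⟨A, -, hA⟩ := exists_subset_image_spinMonomial_eq_spinProduct y
  obtain ⟨L₀, hL₀⟩ := exists_forall_subset_box d A
  set A' : Finset (Site d) := A.filter fun z => meshPos δ z ∈ Ω
  have hA'sub : ∀ L, L₀ ≤ L → A' ⊆ domainBox Ω δ L := fun L hL =>
    subset_domainBox_of_subset_box (fun z hz => (Finset.mem_filter.1 hz).2)
      ((Finset.filter_subset _ _).trans (hL₀ L hL))
  set u : ℕ → ℝ := fun L => isingExpect (zdGraph d) (domainBox Ω δ L) β 0 .plus (spinMonomial y)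
    with hu
  have hu' : ∀ L, L₀ ≤ L → u L = isingCorr (zdGraph d) (domainBox Ω δ L) β 0 .plus A' := by
    intro L hL
    simp only [hu, hA]
    exact isingCorr_plus_domainBox_eq_filter β 0 (hL₀ L hL)
  have hanti : Antitone fun k => u (k + L₀) := by
    refine antitone_nat_of_succ_le fun k => ?_
    rw [hu' _ (by omega), hu' _ (by omega)]
    exact isingCorr_plus_le_of_subset (zdGraph d) hβ le_rfl (hA'sub _ (by omega))
      (domainBox_mono Ω δ (by omega))
  have hbdd : BddBelow (Set.range fun k => u (k + L₀)) := by
    refine ⟨-1, Set.forall_mem_range.2 fun k => ?_⟩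
    rw [hu' _ (by omega)]
    exact (neg_le_neg (abs_isingCorr_le_one _ _ _ _ _ _)).trans (neg_abs_le _)
  have hconv : Tendsto u atTop (𝓝 (⨅ k, u (k + L₀))) :=
    (Filter.tendsto_add_atTop_iff_nat L₀).1 (tendsto_atTop_ciInf hanti hbdd)
  exact tendsto_nhds_limUnder ⟨_, hconv⟩

/-- **Bounded domains: `plusDomainCorr` is an honest finite-volume Gibbs expectation.** If `Ω` is
bounded and `δ ≠ 0` then `Ω_δ` is finite, `L ↦ ⟨∏ᵢ σ_{yᵢ}⟩⁺_{Ω_δ ∩ B(L);β,0}` is eventually constant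
and `plusDomainCorr d Ω δ β n y` is its eventual value (any `β`; Friedli–Velenik 2017, §3.1). [cite: FriedliVelenik2017, §3.1] -/
theorem plusDomainCorr_eq_isingExpect_of_isBounded {Ω : Set (EuclideanSpace ℝ (Fin d))}
    (hΩ : IsBounded Ω) {δ : ℝ} (hδ : δ ≠ 0) (β : ℝ) {n : ℕ} (y : Fin n → Site d) :
    ∀ᶠ L : ℕ in atTop, plusDomainCorr d Ω δ β n y =
      isingExpect (zdGraph d) (domainBox Ω δ L) β 0 .plus (spinMonomial y) := by
  obtain ⟨L₀, hL₀⟩ := exists_forall_domainBox_eq_of_isBounded hΩ hδ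
  have hconst : ∀ L ≥ L₀, isingExpect (zdGraph d) (domainBox Ω δ L) β 0 .plus (spinMonomial y) =
      isingExpect (zdGraph d) (domainBox Ω δ L₀) β 0 .plus (spinMonomial y) := by
    intro L hL; rw [hL₀ L hL]
  filter_upwards [eventually_ge_atTop L₀] with L hL
  exact (hconst L hL).symm ▸ (tendsto_atTop_of_eventually_const hconst).limUnder_eq

/-- **Antitonicity in the domain** (Friedli–Velenik 2017, Exercise 3.12, p. 112, in the limit): for
`β ≥ 0`, `Ω ⊆ Ω'` and sites with `δyᵢ ∈ Ω`, `⟨∏ᵢ σ_{yᵢ}⟩⁺_{Ω'_δ;β,0} ≤ ⟨∏ᵢ σ_{yᵢ}⟩⁺_{Ω_δ;β,0}`. [cite: FriedliVelenik2017, Exercise 3.12, p. 112] -/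
theorem plusDomainCorr_anti_set {β : ℝ} (hβ : 0 ≤ β) {Ω Ω' : Set (EuclideanSpace ℝ (Fin d))}
    (hΩ : Ω ⊆ Ω') {δ : ℝ} {n : ℕ} {y : Fin n → Site d} (hy : ∀ i, meshPos δ (y i) ∈ Ω) :
    plusDomainCorr d Ω' δ β n y ≤ plusDomainCorr d Ω δ β n y := by
  obtain ⟨A, hAy, hA⟩ := exists_subset_image_spinMonomial_eq_spinProduct y
  obtain ⟨L₀, hL₀⟩ := exists_forall_subset_box d A
  have hAΩ := forall_meshPos_mem_of_subset_image hy hAy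
  refine le_of_tendsto_of_tendsto (tendsto_isingExpect_domainBox hβ Ω' δ y)
    (tendsto_isingExpect_domainBox hβ Ω δ y) ?_
  filter_upwards [eventually_ge_atTop L₀] with L hL
  simp only [hA]
  exact isingCorr_plus_le_of_subset (zdGraph d) hβ le_rfl
    (subset_domainBox_of_subset_box hAΩ (hL₀ L hL)) (domainBox_mono_set hΩ δ L)

/-- **The bulk `+` state lies below every `+` domain state** (Friedli–Velenik 2017, Exercise 3.12,
p. 112, with Thm. 3.17, in the limit; `Ω_δ ∩ B(L) ⊆ B(L)`): for `β ≥ 0` and sites with `δyᵢ ∈ Ω`,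
`⟨∏ᵢ σ_{yᵢ}⟩⁺_{β,0} ≤ ⟨∏ᵢ σ_{yᵢ}⟩⁺_{Ω_δ;β,0}`. [cite: FriedliVelenik2017, Exercise 3.12, p. 112] -/
theorem plusExpect_spinMonomial_le_plusDomainCorr {β : ℝ} (hβ : 0 ≤ β)
    (Ω : Set (EuclideanSpace ℝ (Fin d))) {δ : ℝ} {n : ℕ} {y : Fin n → Site d}
    (hy : ∀ i, meshPos δ (y i) ∈ Ω) :
    plusExpect d β 0 (spinMonomial y) ≤ plusDomainCorr d Ω δ β n y := by
  obtain ⟨A, hAy, hA⟩ := exists_subset_image_spinMonomial_eq_spinProduct y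
  obtain ⟨L₀, hL₀⟩ := exists_forall_subset_box d A
  have hAΩ := forall_meshPos_mem_of_subset_image hy hAy
  have hbulk : Tendsto (fun L : ℕ => isingExpect (zdGraph d) (box d L) β 0 .plus (spinMonomial y))
      atTop (𝓝 (plusExpect d β 0 (spinMonomial y))) := by
    simp only [hA]
    exact hasBoxLimit_isingCorr_plus_holds hβ le_rfl A
  refine le_of_tendsto_of_tendsto hbulk (tendsto_isingExpect_domainBox hβ Ω δ y) ?_
  filter_upwards [eventually_ge_atTop L₀] with L hL
  simp only [hA]
  exact isingCorr_plus_le_of_subset (zdGraph d) hβ le_rfl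
    (subset_domainBox_of_subset_box hAΩ (hL₀ L hL)) (domainBox_subset_box Ω δ L)

/-- **The critical bulk correlators lie below every `+` domain state at `β_c`** (`β_c ≥ 0`): for
sites with `δyᵢ ∈ Ω`, `criticalCorr d n y = ⟨∏ᵢ σ_{yᵢ}⟩⁺_{β_c,0} ≤ ⟨∏ᵢ σ_{yᵢ}⟩⁺_{Ω_δ;β_c,0}`. [cite: FriedliVelenik2017, Exercise 3.12, p. 112] -/
theorem criticalCorr_le_plusDomainCorr (Ω : Set (EuclideanSpace ℝ (Fin d))) {δ : ℝ} {n : ℕ}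
    {y : Fin n → Site d} (hy : ∀ i, meshPos δ (y i) ∈ Ω) :
    criticalCorr d n y ≤ plusDomainCorr d Ω δ (criticalBeta d) n y :=
  plusExpect_spinMonomial_le_plusDomainCorr (criticalBeta_nonneg d) Ω hy

/-- **`Ω = ℝ^d` gives the plus state**: `⟨∏ᵢ σ_{yᵢ}⟩⁺_{(ℝ^d)_δ;β,0} = ⟨∏ᵢ σ_{yᵢ}⟩⁺_{β,0}`
(`plusExpect`, the same `limUnder` along the boxes; Friedli–Velenik 2017, Thm. 3.17). [cite: FriedliVelenik2017, Thm. 3.17, p. 106] -/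
@[simp] theorem plusDomainCorr_univ (δ β : ℝ) (n : ℕ) (y : Fin n → Site d) :
    plusDomainCorr d (Set.univ : Set (EuclideanSpace ℝ (Fin d))) δ β n y =
      plusExpect d β 0 (spinMonomial y) := by
  simp only [plusDomainCorr, plusExpect, domainBox_univ]

/-- **`Ω = ℝ^d` at `β = β_c` gives the critical correlators** `criticalCorr d` of
`IsingThermodynamics.lean`. [cite: FriedliVelenik2017, Thm. 3.17, p. 106] -/
theorem plusDomainCorr_univ_criticalBeta (δ : ℝ) :
    plusDomainCorr d (Set.univ : Set (EuclideanSpace ℝ (Fin d))) δ (criticalBeta d) = criticalCorr d := by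
  funext n y
  exact plusDomainCorr_univ δ _ n y

/-- **Exact dilation consistency**: `⟨∏ᵢ σ_{yᵢ}⟩⁺_{(cΩ)_{cδ};β,0} = ⟨∏ᵢ σ_{yᵢ}⟩⁺_{Ω_δ;β,0}` for
`c ≠ 0`, since `(cΩ)_{cδ} = Ω_δ` as lattice regions. [folklore] -/
theorem plusDomainCorr_smul {c : ℝ} (hc : c ≠ 0) (Ω : Set (EuclideanSpace ℝ (Fin d))) (δ β : ℝ) :
    plusDomainCorr d (c • Ω) (c * δ) β = plusDomainCorr d Ω δ β := by
  funext n y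
  simp only [plusDomainCorr, domainBox_smul hc]

/-- **`0 ≤ ⟨∏ᵢ σ_{yᵢ}⟩⁺_{Ω_δ;β,0}`** for `β ≥ 0` (first Griffiths inequality in each finite volume,
Friedli–Velenik 2017, Thm. 3.20, eq. (3.21), passed to the limit). [cite: FriedliVelenik2017, Thm. 3.20, eq. (3.21), p. 109] -/
theorem plusDomainCorr_nonneg {β : ℝ} (hβ : 0 ≤ β) (Ω : Set (EuclideanSpace ℝ (Fin d))) (δ : ℝ)
    {n : ℕ} (y : Fin n → Site d) : 0 ≤ plusDomainCorr d Ω δ β n y := by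
  obtain ⟨A, -, hA⟩ := exists_subset_image_spinMonomial_eq_spinProduct y
  refine ge_of_tendsto (tendsto_isingExpect_domainBox hβ Ω δ y) (Eventually.of_forall fun L => ?_)
  simp only [hA]
  show 0 ≤ isingCorr (zdGraph d) (domainBox Ω δ L) β 0 .plus A
  rw [isingCorr_plus_eq_filter]
  exact GKSInequalities.gks_one_holds (zdGraph d) hβ le_rfl (Or.inr rfl)
    (fun z hz => (Finset.mem_filter.1 hz).2)

/-- **`⟨∏ᵢ σ_{yᵢ}⟩⁺_{Ω_δ;β,0} ≤ 1`** for `β ≥ 0` (`|∏ᵢ σ_{yᵢ}| = 1` in each finite volume). [folklore] -/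
theorem plusDomainCorr_le_one {β : ℝ} (hβ : 0 ≤ β) (Ω : Set (EuclideanSpace ℝ (Fin d))) (δ : ℝ)
    {n : ℕ} (y : Fin n → Site d) : plusDomainCorr d Ω δ β n y ≤ 1 := by
  obtain ⟨A, -, hA⟩ := exists_subset_image_spinMonomial_eq_spinProduct y
  refine le_of_tendsto' (tendsto_isingExpect_domainBox hβ Ω δ y) fun L => ?_
  simp only [hA]
  exact (le_abs_self _).trans (abs_isingCorr_le_one (zdGraph d) _ _ _ _ A)

/-! ### Scaling limits of `+` domain correlations -/

variable (d) in
/-- **Scaling limit of the `+` correlations of a discretised domain.** The renormalised `+`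
boundary-condition correlations of `Ω_δ`, `x ↦ ρ(δ)ⁿ ⟨∏ᵢ σ_{[xᵢ/δ]}⟩⁺_{Ω_δ;β,0}`, converge as
`δ → 0⁺` to `S n`, locally uniformly on the non-coincident configurations of points of `Ω`, for
every `n` — the shape of Chelkak–Hongler–Izyurov 2015, Thm. 1.2 (bounded planar domains, `β = β_c`,
`ρ(δ) = δ^{-1/8}`), on `ℝ^d` with a general `ρ` as in `HasPointwiseScalingLimit`. [cite: ChelkakHonglerIzyurov2015, Thm. 1.2] -/
def HasDomainScalingLimit (Ω : Set (EuclideanSpace ℝ (Fin d))) (β : ℝ) (ρ : ℝ → ℝ)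
    (S : CorrFamily d) : Prop :=
  ∀ n, TendstoLocallyUniformlyOn
    (fun δ x => ρ δ ^ n * plusDomainCorr d Ω δ β n (fun i => latticeApprox δ (x i))) (S n)
    (𝓝[>] (0 : ℝ)) (NonCoincident d n ∩ {x | ∀ i, x i ∈ Ω})

/-- For `Ω = ℝ^d` and `β = β_c`, a domain scaling limit is exactly a pointwise scaling limit
(`ScalingLimit.lean`) of the critical correlators, `HasPointwiseScalingLimit (criticalCorr d) ρ S`
(the hypothesis of the `CriticalPhenomena` summit statements). [folklore] -/
theorem hasDomainScalingLimit_univ_criticalBeta_iff (ρ : ℝ → ℝ) (S : CorrFamily d) :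
    HasDomainScalingLimit d Set.univ (criticalBeta d) ρ S ↔
      HasPointwiseScalingLimit (criticalCorr d) ρ S := by
  simp only [HasDomainScalingLimit, HasPointwiseScalingLimit, plusDomainCorr_univ_criticalBeta,
    Set.mem_univ, implies_true, Set.setOf_true, Set.inter_univ]
  rfl

end Zd

end Literature.Probability.LatticeModels
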